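import Mathlib
import HarnessLib
import Summits.NavierStokesRegularity.NavierStokesRegularity.Theorems.PoloidalWindowDoorLrcModEntireFermiTimeWebPackage
import Summits.NavierStokesRegularity.NavierStokesRegularity.Theorems.PoloidalWindowDoorLrcModEntireFermiTimeWebNonVertical

/-!
# Route `PoloidalWindowDoor`, item `LrcModEntire` (stmt-NavierStokesRegularity-20428), cell (Q4-sonic, straight, μ < 0) `stub_Q4sonicLineNeg`, case II —
# BRICK B-TWPc, PART T5: THE CURVED TIME-WEB PACKAGE AT A GENERAL BASE TIME IN ONE CALL (END′ currency)

Cell ns-regularity-ideate, stub-worker seat ns-poloidal-K2-p2 g18 under the LEAD of item 20428 (ns-poloidal-K2-p3 g17/g18);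
`--supports stmt-NavierStokesRegularity-20428 --as helper`.  Memo `Cruxes/LrcModEntire/TOWER-CLOSES-port2g9.md` §D2/§E; interface memo B-TWPc-K2p2g18.md (evidence on
⟨20428⟩, HOME ns-poloidal-K2-p2/g18/).  Pure packaging of T1 (`…BaseWebArclength`), T3b-2 (`…FermiTimeWebPackage`) and T4 (`…FermiTimeWebNonVertical`) for the
v15 assembly (port-2 g9): every hypothesis below is a hypothesis of the curved END `…CaseIIEntranceSharp.caseII_false_of_curvedEnd'` (class data, slab law,
`μ ∈ C³`, the frame-form concavity on the `δ`-box, the `δ′`-box package `hpack`, webs parallel at `τ = 0`, `μ < 0` on the box, the LINE lever) — no `τ = 0`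
normalisation, no sonic literal.

★★★ `curved_timeWeb_at` — ∃ `τ* ≤ δ′` such that for every base time `|τ₁| < τ*`: the Huygens factor at the base height is positive; the unit-speed base web `Γ`
of time `τ₁` with inverse arclength `φ` and Frenet curvature `k₁` (all `C^∞`, T1's identities); J3 «`k₁ ≡ 0` ⇒ `n₀(τ₁,s,0) = n₀(τ₁,0,0)`» (so the pole argument's
output `k₁ ≡ 0` contradicts the lever at the non-sonic `τ₁`); and for every base point `σ₀` the local Fermi-frame package of T3b-2 (box, `G₁`, `S`, pin, Fermi
factor, «Fermi point = line-frame web point», criticality, value, ridge law, slice law, Fermi Huygens family, parallel webs) plus `∂_zG₁(τ₁,σ₀,·) ≠ 0` on a height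
window (T4).  WHAT THIS IS NOT: not a claim about Navier–Stokes regularity; closes nothing; items 20428 / 19708 / 27893 OPEN (bears_on LADDER-NS N0).
-/

noncomputable section

set_option linter.dupNamespace false
set_option linter.style.longLine false

namespace Summit.NavierStokesRegularity.NavierStokesRegularity.Theorems.PoloidalWindowDoorLrcModEntireFermiTimeWebAt

open Set Function Filter Topology Metric
open scoped RealInnerProductSpace InnerProductSpace ContDiff
open Literature.Analysis Literature.Analysis.FluidPDE Literature.Analysis.UnboundedOperators
open Summit.NavierStokesRegularity.NavierStokesRegularity.Theorems
open Summit.NavierStokesRegularity.NavierStokesRegularity.Theorems.PoloidalWindowDoorLrcModEntireSheetFlattenTools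
open Summit.NavierStokesRegularity.NavierStokesRegularity.Theorems.PoloidalWindowDoorLrcModEntireRidgeGlobalBranchODE
open Summit.NavierStokesRegularity.NavierStokesRegularity.Theorems.PoloidalWindowDoorLrcModEntireRidgeGlobalBranchFrame
open Summit.NavierStokesRegularity.NavierStokesRegularity.Theorems.PoloidalWindowDoorLrcModEntireQ4TimeWebFunction
open Summit.NavierStokesRegularity.NavierStokesRegularity.Theorems.PoloidalWindowDoorLrcModEntireWebPackageAnalytic
open Summit.NavierStokesRegularity.NavierStokesRegularity.Theorems.PoloidalWindowDoorLrcModEntireBaseWebArclength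
open Summit.NavierStokesRegularity.NavierStokesRegularity.Theorems.PoloidalWindowDoorLrcModEntireFermiTimeWebGeometry
open Summit.NavierStokesRegularity.NavierStokesRegularity.Theorems.PoloidalWindowDoorLrcModEntireFermiTimeWebPackage
open Summit.NavierStokesRegularity.NavierStokesRegularity.Theorems.PoloidalWindowDoorLrcModEntireFermiTimeWebNonVertical

variable {C : ℝ} {U : ℝ → EuclideanSpace ℝ (Fin 3) → EuclideanSpace ℝ (Fin 3)}

/-- ★★★ **B-TWPc IN ONE CALL.**  From the curved END's data alone: a time window `τ* ≤ δ′` and, for every base time `|τ₁| < τ*`, the unit-speed base web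
`Γ` of time `τ₁` (T1) with its inverse arclength `φ` and Frenet curvature `k₁`, the pinned-⇒-contradiction-ready fact «`k₁ ≡ 0` ⇒ the base web is `e`-parallel»
(J3), and for every base point `σ₀` the local Fermi-frame time-web package (T3b-2) together with the non-verticality of the parallel offset (T4). -/
theorem curved_timeWeb_at
    (hUrate : HasTypeITimeDecay C U) (hUcont : ContinuousOn (uncurry U) (Iio (0 : ℝ) ×ˢ univ))
    (hUmild : ∀ s t : ℝ, s < t → t < 0 → ∀ x, U t x = heatExtension (U s) (t - s) x - oseenDuhamel 1 s U U t x)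
    (hUdiv : ∀ t < 0, VectorCalculus.IsDivFree (U t))
    {σ : ℝ} {ρ : ℝ} {μ : ℝ → ℝ → ℝ} (hμ3 : ContDiff ℝ 3 (uncurry μ))
    (hslabU : ∀ t : ℝ, |t + 1| < ρ → ∀ x : EuclideanSpace ℝ (Fin 3), |x 2| < ρ → ∀ b : Fin 3, b ≠ 2 →
      fderiv ℝ (U t) x (EuclideanSpace.single 2 1) b = μ t (x 2) * fderiv ℝ (U t) x (EuclideanSpace.single b 1) 2)
    {e : EuclideanSpace ℝ (Fin 3)} (he2 : e 2 = 0) (hunit : e 0 ^ 2 + e 1 ^ 2 = 1)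
    {r δ δ' : ℝ} {R : ℝ → ℝ → ℝ} {n₀ : ℝ × ℝ × ℝ → ℝ} {κt : ℝ → ℝ → ℝ} (hδ'δ : δ' ≤ δ) (hδ'ρ : δ' ≤ ρ) (hδ'h : δ' < 1 / 2)
    (hconcF : ∀ τ z : ℝ, |τ| < δ → |z| < δ → ∀ s : ℝ, ∀ n ∈ Ioo (-r) r,
      fderiv ℝ (fderiv ℝ (fun y => σ * U (-1 + τ) y 2)) (frameCLM e (s, n, z)) (Jvec e) (Jvec e) < 0)
    (hpack : ∀ q : ℝ × ℝ × ℝ, |q.1| < δ' → |q.2.2| < δ' →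
      n₀ q ∈ Ioo (-r) r ∧
      σ * U (-1 + q.1) (frameCLM e (q.2.1, n₀ q, q.2.2)) 2 = R q.1 q.2.2 ∧
      (∀ n ∈ Icc (-r) r, n ≠ n₀ q → σ * U (-1 + q.1) (frameCLM e (q.2.1, n, q.2.2)) 2 < R q.1 q.2.2) ∧
      (∀ w : EuclideanSpace ℝ (Fin 3), w 2 = 0 → fderiv ℝ (fun y => U (-1 + q.1) y 2) (frameCLM e (q.2.1, n₀ q, q.2.2)) w = 0) ∧
      (∀ m : ℕ∞, ContDiffAt ℝ m n₀ q) ∧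
      0 < κt q.1 q.2.2 ∧
      fderiv ℝ (fderiv ℝ (fun y => σ * U (-1 + q.1) y 2)) (frameCLM e (q.2.1, n₀ q, q.2.2)) e e +
          fderiv ℝ (fderiv ℝ (fun y => σ * U (-1 + q.1) y 2)) (frameCLM e (q.2.1, n₀ q, q.2.2)) (Jvec e) (Jvec e) =
        -κt q.1 q.2.2 ∧
      κt q.1 q.2.2 * (fderiv ℝ n₀ q ((0 : ℝ), (0 : ℝ), (1 : ℝ))) ^ 2 =
        (deriv (deriv (R q.1)) q.2.2 - μ (-1 + q.1) q.2.2 * κt q.1 q.2.2) * (1 + (fderiv ℝ n₀ q ((0 : ℝ), (1 : ℝ), (0 : ℝ))) ^ 2))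
    (hδ : 0 < δ) (hδ'pos : 0 < δ')
    (hpar0 : ∀ s z : ℝ, |z| < δ' → n₀ ((0 : ℝ), s, z) = n₀ ((0 : ℝ), (0 : ℝ), z))
    (hμnegB : ∀ τ z : ℝ, |τ| < δ' → |z| < δ' → μ (-1 + τ) z < 0)
    (hunpin : ∀ τ : ℝ, |τ| < δ' → ¬ (∃ a b : ℝ, ∀ z : ℝ, |z| < δ → R τ z = a + b * z) →
      ∃ s : ℝ, n₀ (τ, s, (0 : ℝ)) ≠ n₀ (τ, (0 : ℝ), (0 : ℝ))) :
    ∃ τs : ℝ, 0 < τs ∧ τs ≤ δ' ∧ ∀ τ₁ : ℝ, |τ₁| < τs →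
      0 < deriv (deriv (R τ₁)) 0 - μ (-1 + τ₁) 0 * κt τ₁ 0 ∧
      ∃ (Γ : ℝ → EuclideanSpace ℝ (Fin 3)) (φ k₁ : ℝ → ℝ),
        (ContDiff ℝ ∞ Γ ∧ ContDiff ℝ ∞ φ ∧ ContDiff ℝ ∞ k₁ ∧ StrictMono φ ∧ Function.Surjective φ ∧ φ 0 = 0 ∧
          (∀ s, HasDerivAt φ (1 / Real.sqrt (1 + deriv (fun s' => n₀ (τ₁, s', 0)) (φ s) ^ 2)) s) ∧
          (∀ s, Γ s = φ s • e + n₀ (τ₁, φ s, 0) • Jvec e) ∧ (∀ s, Γ s 2 = 0) ∧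
          (∀ s, deriv Γ s = (1 / Real.sqrt (1 + deriv (fun s' => n₀ (τ₁, s', 0)) (φ s) ^ 2)) •
            (e + deriv (fun s' => n₀ (τ₁, s', 0)) (φ s) • Jvec e)) ∧ (∀ s, ‖deriv Γ s‖ = 1) ∧
          (∀ s, k₁ s = deriv (deriv (fun s' => n₀ (τ₁, s', 0))) (φ s) / Real.sqrt (1 + deriv (fun s' => n₀ (τ₁, s', 0)) (φ s) ^ 2) ^ 3) ∧
          (∀ s, deriv (deriv Γ) s = k₁ s • rotJ (deriv Γ s))) ∧
        -- J3: zero curvature pins the base web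
        ((∀ s, k₁ s = 0) → ∀ s, n₀ (τ₁, s, 0) = n₀ (τ₁, 0, 0)) ∧
        -- the local package at every base point, with the transversal parallel offset
        ∀ σ₀ : ℝ,
          ∃ ε₁ : ℝ, 0 < ε₁ ∧ ∃ G₁ S : ℝ × ℝ × ℝ → ℝ,
            ContDiffOn ℝ ∞ G₁ {q : ℝ × ℝ × ℝ | |q.1 - τ₁| < ε₁ ∧ |q.2.1 - σ₀| < ε₁ ∧ |q.2.2| < ε₁} ∧
            (∀ s : ℝ, |s - σ₀| < ε₁ → G₁ (τ₁, s, 0) = 0) ∧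
            (∀ q : ℝ × ℝ × ℝ, |q.1 - τ₁| < ε₁ → |q.2.1 - σ₀| < ε₁ → |q.2.2| < ε₁ →
              |q.1| < δ' ∧ |q.2.2| < δ' ∧ 1 - k₁ q.2.1 * G₁ q ≠ 0 ∧
              -- the Fermi point IS the line-frame web point at the line parameter `S q` (so every conjunct of `hpack` / the web Fermat law applies at it)
              Γ q.2.1 + G₁ q • rotJ (deriv Γ q.2.1) + q.2.2 • e2 = frameCLM e (S q, n₀ (q.1, S q, q.2.2), q.2.2) ∧
              -- criticality, value, ridge law, slice law at the Fermi point
              fderiv ℝ (fun y => σ * U (-1 + q.1) y 2) (Γ q.2.1 + G₁ q • rotJ (deriv Γ q.2.1) + q.2.2 • e2) (rotJ (deriv Γ q.2.1)) = 0 ∧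
              fderiv ℝ (fun y => σ * U (-1 + q.1) y 2) (Γ q.2.1 + G₁ q • rotJ (deriv Γ q.2.1) + q.2.2 • e2) (deriv Γ q.2.1) = 0 ∧
              σ * U (-1 + q.1) (Γ q.2.1 + G₁ q • rotJ (deriv Γ q.2.1) + q.2.2 • e2) 2 = R q.1 q.2.2 ∧
              fderiv ℝ (fderiv ℝ (fun y => σ * U (-1 + q.1) y 2)) (Γ q.2.1 + G₁ q • rotJ (deriv Γ q.2.1) + q.2.2 • e2) (deriv Γ q.2.1) (deriv Γ q.2.1) +
                  fderiv ℝ (fderiv ℝ (fun y => σ * U (-1 + q.1) y 2)) (Γ q.2.1 + G₁ q • rotJ (deriv Γ q.2.1) + q.2.2 • e2)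
                    (rotJ (deriv Γ q.2.1)) (rotJ (deriv Γ q.2.1)) = -κt q.1 q.2.2 ∧
              fderiv ℝ (fderiv ℝ (fun y => σ * U (-1 + q.1) y 2)) (Γ q.2.1 + G₁ q • rotJ (deriv Γ q.2.1) + q.2.2 • e2) e2 e2 =
                -μ (-1 + q.1) q.2.2 *
                  (fderiv ℝ (fderiv ℝ (fun y => σ * U (-1 + q.1) y 2)) (Γ q.2.1 + G₁ q • rotJ (deriv Γ q.2.1) + q.2.2 • e2) (deriv Γ q.2.1) (deriv Γ q.2.1) +
                    fderiv ℝ (fderiv ℝ (fun y => σ * U (-1 + q.1) y 2)) (Γ q.2.1 + G₁ q • rotJ (deriv Γ q.2.1) + q.2.2 • e2)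
                      (rotJ (deriv Γ q.2.1)) (rotJ (deriv Γ q.2.1))) ∧
              -- the Fermi HUYGENS FAMILY
              κt q.1 q.2.2 * (1 - k₁ q.2.1 * G₁ q) ^ 2 * (fderiv ℝ G₁ q ((0 : ℝ), (0 : ℝ), (1 : ℝ))) ^ 2 =
                (deriv (deriv (R q.1)) q.2.2 - μ (-1 + q.1) q.2.2 * κt q.1 q.2.2) *
                  ((1 - k₁ q.2.1 * G₁ q) ^ 2 + (fderiv ℝ G₁ q ((0 : ℝ), (1 : ℝ), (0 : ℝ))) ^ 2)) ∧
            -- PARALLEL WEBS at the base time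
            (∀ s s' z : ℝ, |s - σ₀| < ε₁ → |s' - σ₀| < ε₁ → |z| < ε₁ → G₁ (τ₁, s, z) = G₁ (τ₁, s', z)) ∧
            ∃ ε₂ : ℝ, 0 < ε₂ ∧ ε₂ ≤ ε₁ ∧ ∀ z : ℝ, |z| < ε₂ → fderiv ℝ G₁ (τ₁, σ₀, z) ((0 : ℝ), (0 : ℝ), (1 : ℝ)) ≠ 0 := by
  have hδ'h2 : δ' ≤ 1 / 2 := hδ'h.le
  have h0δ' : |(0 : ℝ)| < δ' := by simpa using hδ'pos
  -- `hpack` ingredients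
  have hθd : ∀ τ : ℝ, |τ| < δ' → Differentiable ℝ (fun y => U (-1 + τ) y 2) := fun τ hτ =>
    (contDiff_two_vert_at hUrate hUcont hUmild hUdiv (lt_trans hτ hδ'h)).differentiable (by norm_num)
  have hconc' : ∀ τ z : ℝ, |τ| < δ' → |z| < δ' → ∀ s : ℝ, ∀ n ∈ Ioo (-r) r,
      fderiv ℝ (fderiv ℝ (fun y => σ * U (-1 + τ) y 2)) (frameCLM e (s, n, z)) (Jvec e) (Jvec e) < 0 := fun τ z hτ hz =>
    hconcF τ z (lt_of_lt_of_le hτ hδ'δ) (lt_of_lt_of_le hz hδ'δ)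
  have hn₀' : ∀ q : ℝ × ℝ × ℝ, |q.1| < δ' → |q.2.2| < δ' → n₀ q ∈ Ioo (-r) r := fun q h1 h2 => (hpack q h1 h2).1
  have hcrit' : ∀ q : ℝ × ℝ × ℝ, |q.1| < δ' → |q.2.2| < δ' →
      fderiv ℝ (fun y => σ * U (-1 + q.1) y 2) (frameCLM e (q.2.1, n₀ q, q.2.2)) (Jvec e) = 0 := by
    intro q h1 h2
    have h := (hpack q h1 h2).2.2.2.1 (Jvec e) (by simp [Jvec])
    rw [show (fun y => σ * U (-1 + q.1) y 2) = fun y => σ * (fun y' => U (-1 + q.1) y' 2) y from rfl,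
      fderiv_const_mul (hθd q.1 h1 _) σ]
    simp [h]
  have hn₀an : ∀ q : ℝ × ℝ × ℝ, |q.1| < δ' → |q.2.2| < δ' → AnalyticAt ℝ n₀ q := fun q h1 h2 =>
    webFunction_analyticAt hUrate hUcont hUmild hUdiv hδ'h2 hconc' hn₀' hcrit' h1 h2
  have hC1 : ∀ q : ℝ × ℝ × ℝ, |q.1| < δ' → |q.2.2| < δ' → ContDiffAt ℝ 1 n₀ q := fun q h1 h2 => (hpack q h1 h2).2.2.2.2.1 1
  have hκ' : ∀ q : ℝ × ℝ × ℝ, |q.1| < δ' → |q.2.2| < δ' → 0 < κt q.1 q.2.2 := fun q h1 h2 => (hpack q h1 h2).2.2.2.2.2.1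
  have hHuy' : ∀ q : ℝ × ℝ × ℝ, |q.1| < δ' → |q.2.2| < δ' →
      κt q.1 q.2.2 * (fderiv ℝ n₀ q ((0 : ℝ), (0 : ℝ), (1 : ℝ))) ^ 2 =
        (deriv (deriv (R q.1)) q.2.2 - μ (-1 + q.1) q.2.2 * κt q.1 q.2.2) * (1 + (fderiv ℝ n₀ q ((0 : ℝ), (1 : ℝ), (0 : ℝ))) ^ 2) :=
    fun q h1 h2 => (hpack q h1 h2).2.2.2.2.2.2.2
  have hμ0 : μ (-1) 0 < 0 := by simpa using hμnegB 0 0 h0δ' h0δ'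
  have hun : ‖e‖ = 1 := by
    have h := norm_sq_eq_sum3 e
    rw [he2] at h
    have h1 : ‖e‖ ^ 2 = 1 := by rw [h]; linear_combination hunit
    nlinarith [norm_nonneg e]
  /- STEP 0: the time window (T4). -/
  obtain ⟨τs, hτs, hτsδ, hfac⟩ := transversal_factor_pos_near_zero hδ hδ'pos hC1 hκ' hHuy' hpar0 hμ0 hunpin
  refine ⟨τs, hτs, hτsδ, fun τ₁ hτ₁ => ?_⟩
  have hτ₁δ : |τ₁| < δ' := lt_of_lt_of_le hτ₁ hτsδ
  refine ⟨hfac τ₁ hτ₁, ?_⟩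
  /- STEP 1: the unit-speed base web of time `τ₁` (T1). -/
  have hg : ContDiff ℝ ∞ (fun s' => n₀ (τ₁, s', 0)) := contDiff_baseGraph (τ₁ := τ₁) fun s => hn₀an (τ₁, s, 0) hτ₁δ h0δ'
  obtain ⟨Γ, φ, k₁, hΓcd, hφ, hk₁, hφmono, hφsurj, hφ0, hφd, hΓφ, hΓ2, hΓ', hΓunit, hk₁form, hfrenet⟩ := exists_unitSpeed_graph he2 hun hg
  refine ⟨Γ, φ, k₁, ⟨hΓcd, hφ, hk₁, hφmono, hφsurj, hφ0, hφd, hΓφ, hΓ2, hΓ', hΓunit, hk₁form, hfrenet⟩, ?_, fun σ₀ => ?_⟩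
  · /- J3: zero curvature pins the base web. -/
    intro hk0
    have hg'' : ∀ t : ℝ, deriv (deriv (fun s' => n₀ (τ₁, s', 0))) t = 0 := by
      intro t
      obtain ⟨σ₁, hσ₁⟩ := hφsurj t
      have h := hk₁form σ₁
      rw [hk0 σ₁, hσ₁] at h
      have hv : 0 < Real.sqrt (1 + deriv (fun s' => n₀ (τ₁, s', 0)) t ^ 2) ^ 3 := pow_pos (speed_pos (g := fun s' => n₀ (τ₁, s', 0)) t) 3
      rcases div_eq_zero_iff.1 h.symm with h1 | h1
      · exact h1
      · exact absurd h1 hv.ne'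
    have hb : ∀ s : ℝ, |n₀ (τ₁, s, 0)| ≤ r := fun s => by
      have h := hn₀' (τ₁, s, 0) hτ₁δ h0δ'
      exact (abs_lt.2 ⟨h.1, h.2⟩).le
    exact graph_pinned_of_curvature_zero hg hb hg''
  · /- the local package at `σ₀` (T3b-2) and the transversal offset (T4). -/
    obtain ⟨ε₁, hε₁, G₁, S, hG, hpin, hq, hparr⟩ := fermi_timeWeb_package hUrate hUcont hUmild hUdiv hμ3 hslabU he2 hunit hδ'δ hδ'ρ hδ'h hconcF hpack hτ₁δ σ₀
      hΓcd hφ hk₁ hΓφ hΓ2 hΓ' hΓunit hfrenet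
    have hHuy0 : ∀ z : ℝ, |z| < ε₁ →
        κt τ₁ z * (1 - k₁ σ₀ * G₁ (τ₁, σ₀, z)) ^ 2 * (fderiv ℝ G₁ (τ₁, σ₀, z) ((0 : ℝ), (0 : ℝ), (1 : ℝ))) ^ 2 =
          (deriv (deriv (R τ₁)) z - μ (-1 + τ₁) z * κt τ₁ z) *
            ((1 - k₁ σ₀ * G₁ (τ₁, σ₀, z)) ^ 2 + (fderiv ℝ G₁ (τ₁, σ₀, z) ((0 : ℝ), (1 : ℝ), (0 : ℝ))) ^ 2) := by
      intro z hz
      exact (hq (τ₁, σ₀, z) (by simpa using hε₁) (by simpa using hε₁) (by simpa using hz)).2.2.2.2.2.2.2.2.2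
    obtain ⟨ε₂, hε₂, hε₂₁, htrans⟩ := fermi_offset_transversal hε₁ hG hpin hHuy0 (hfac τ₁ hτ₁)
    exact ⟨ε₁, hε₁, G₁, S, hG, hpin, hq, hparr, ε₂, hε₂, hε₂₁, htrans⟩

end Summit.NavierStokesRegularity.NavierStokesRegularity.Theorems.PoloidalWindowDoorLrcModEntireFermiTimeWebAt

end
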